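import Summits.Ventures.HSemireg.WedgeHankelRankOneDegrees
import Summits.Ventures.HSemireg.WedgeHankelDegenerate

/-!
# Venture HSemireg — A LARGE KERNEL IN ANY ONE DEGREE FORCES DEGENERACY: for th-7's class `w_N(q)` and ANY degree `1 ≤ k ≤ N − 1`,
# **`rank H_k(q) ≤ 1 ⟺ Kr(univ, w_N(q), 1) ≠ 0 ⟺ dim Kr(univ, w_N(q), k) ≥ C(2N,k) − C(N,k)`**, and then D8's trichotomy applies: the class is ZERO, PURE (`A·u^λ_0 ∧ ⋯ ∧ u^λ_{N−1}`,
# kernels the frame ideals `F_λ(k)`) or THE POINT (kernels `F_∞(k)`); contrapositively a class killed by no `1`-form has `rank H_k(q) ≥ 2` and `dim Kr(univ, w_N(q), k) ≤ C(2N,k) − 2·C(N,k)`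
# in every degree `1 ≤ k ≤ N − 1`

HONEST FRAMING. Part of the Lean index of the computation cell `pub-hsemireg` (seat p10 gen 25, Sunday typer «UNIFORM-IN-n»).
Finite-dimensional EXTERIOR ALGEBRA over a field + ranks of Hankel matrices ONLY: no variety, no cohomology theory, no sheaf, no Ext group, no semiregularity map; nothing here says that
HC / HC_CM / HC_AV holds; no Literature fact is declared or used.  Custodian versions as in `WedgeHankelDegenerate` (D8) and `WedgeHankelRankOne`; the dictionary («degenerate» = killed by a
`1`-form; pure class / point class; frame ideals) is QUOTED, never asserted.

WHAT IS IN THE TREE / KEYED.  D8 (`WedgeHankelDegenerate`): `Kr_w_one_ne_bot_iff` (`Kr(univ, w_m(q), 1) ≠ ⊥ ⟺ rank H_1(q) ≤ 1`), **`degenerate_trichotomy`** (zero / pure / point, with all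
kernels named); K-series `HankelBoxKernel.finrank_Kr_w_add` (`dim Kr(univ, w_m(q), a) + C(m,a)·rank H_a(q) = C(2m,a)`); N11 (`WedgeHankelRankOneDegrees`, keyed)
`rank_hankel1_le_one_iff_rank_hankel1_one_le_one` (RANK ONE IS DEGREE-INDEPENDENT).
THIS FILE (namespace `Summit.Ventures.HSemireg.Wedge.HankelOuter` continued; CHAINED on N11; imports D8):
* §454 **`rank_hankel1_le_one_iff_Kr_w_one_ne_bot`** (`1 ≤ k ≤ N − 1`: `rank H_k(q) ≤ 1 ↔ Kr(univ, w_N q, 1) ≠ ⊥`), **`rank_hankel1_le_one_iff_choose_le_finrank_Kr_w_add`**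
  (`↔ C(2N,k) ≤ dim Kr(univ, w_N q, k) + C(N,k)`), `Kr_w_one_ne_bot_iff_choose_le_finrank_Kr_w_add` (degeneracy read off ANY degree), **`degenerate_trichotomy_of_rank_hankel1_le_one`**,
  **`degenerate_trichotomy_of_choose_le_finrank_Kr_w_add`** (A CLASS WHOSE DEGREE-`k` KERNEL HAS CODIMENSION `≤ C(N,k)` IN `Hom(univ,k)`'s count `C(2N,k)` IS ZERO, PURE OR THE POINT),
  **`two_le_rank_hankel1_of_Kr_w_one_eq_bot`** / **`finrank_Kr_w_add_two_mul_choose_le_of_Kr_w_one_eq_bot`** (NON-DEGENERATE ⇒ `rank H_k(q) ≥ 2` and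
  `dim Kr(univ, w_N q, k) + 2·C(N,k) ≤ C(2N,k)` for every `1 ≤ k ≤ N − 1`).
READING: D8 detected degeneracy in degree `1`; it can be detected — with the same threshold «one `C(N,k)` of excess» — in any intermediate degree, uniformly in `N`.  Nothing Ext-side.  New names only.
-/

open Module

namespace Summit.Ventures.HSemireg.Wedge.HankelOuter

open Summit.Ventures.HSemireg.Wedge Summit.Ventures.HSemireg.Wedge.Kunneth Summit.Ventures.HSemireg.Wedge.KunnethKernel Summit.Ventures.HSemireg.Wedge.Hankel
  Summit.Ventures.HSemireg.Wedge.HankelFaces Summit.Ventures.HSemireg.Wedge.HankelBox Summit.Ventures.HSemireg.Wedge.HankelPureKernel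
  Summit.Ventures.HSemireg.Wedge.HankelBoxKernel Summit.Ventures.HSemireg.Wedge.HankelRankOne

variable (K : Type*) [Field K] {N : ℕ}

/-! ## §454. Degeneracy read off any degree -/

/-- **`rank H_k(q) ≤ 1 ↔ Kr(univ, w_N(q), 1) ≠ ⊥`** for every `1 ≤ k ≤ N − 1` (N11's degree-independence + D8's `Kr_w_one_ne_bot_iff`). -/
theorem rank_hankel1_le_one_iff_Kr_w_one_ne_bot {k : ℕ} (hk : 1 ≤ k) (hkN : k + 1 ≤ N) (q : ℕ → K) :
    (hankel1 K N k q).rank ≤ 1 ↔ Kr K Finset.univ (w K N N q) 1 ≠ ⊥ := by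
  rw [rank_hankel1_le_one_iff_rank_hankel1_one_le_one K hk hkN q, Kr_w_one_ne_bot_iff K N (by omega) q]

/-- **`rank H_k(q) ≤ 1 ↔ C(2N,k) ≤ dim Kr(univ, w_N(q), k) + C(N,k)`** (`k ≤ N`): at most one `C(N,k)` short of everything (`dim Kr + C(N,k)·rank H_k = C(2N,k)`). -/
theorem rank_hankel1_le_one_iff_choose_le_finrank_Kr_w_add {k : ℕ} (hkN : k ≤ N) (q : ℕ → K) :
    (hankel1 K N k q).rank ≤ 1 ↔ (N + N).choose k ≤ finrank K ↥(Kr K Finset.univ (w K N N q) k) + N.choose k := by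
  have h := finrank_Kr_w_add K N k q
  have hpos := Nat.choose_pos hkN
  constructor
  · intro h1
    have : N.choose k * (hankel1 K N k q).rank ≤ N.choose k * 1 := Nat.mul_le_mul_left _ h1
    omega
  · intro h1
    by_contra h2
    have : N.choose k * 2 ≤ N.choose k * (hankel1 K N k q).rank := Nat.mul_le_mul_left _ (by omega)
    omega

/-- **DEGENERACY READ OFF ANY DEGREE: `Kr(univ, w_N(q), 1) ≠ ⊥ ↔ C(2N,k) ≤ dim Kr(univ, w_N(q), k) + C(N,k)`** for every `1 ≤ k ≤ N − 1`. -/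
theorem Kr_w_one_ne_bot_iff_choose_le_finrank_Kr_w_add {k : ℕ} (hk : 1 ≤ k) (hkN : k + 1 ≤ N) (q : ℕ → K) :
    Kr K Finset.univ (w K N N q) 1 ≠ ⊥ ↔ (N + N).choose k ≤ finrank K ↥(Kr K Finset.univ (w K N N q) k) + N.choose k := by
  rw [← rank_hankel1_le_one_iff_Kr_w_one_ne_bot K hk hkN q, rank_hankel1_le_one_iff_choose_le_finrank_Kr_w_add K (by omega) q]

/-- **D8 FROM ANY DEGREE: `rank H_k(q) ≤ 1` for some `1 ≤ k ≤ N − 1` ⇒ the class is ZERO, PURE (with kernels the frame ideals `F_λ(k′)`, `k′ ≥ 1`) or THE POINT (kernels `F_∞(k′)`).** -/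
theorem degenerate_trichotomy_of_rank_hankel1_le_one {k : ℕ} (hk : 1 ≤ k) (hkN : k + 1 ≤ N) {q : ℕ → K} (h : (hankel1 K N k q).rank ≤ 1) :
    w K N N q = 0 ∨
    (∃ A lam : K, A ≠ 0 ∧ (∀ j ≤ N, q j = A * lam ^ j) ∧ w K N N q = A • uprod K N lam N ∧
        ∀ k', 1 ≤ k' → Kr K Finset.univ (w K N N q) k' = frameIdeal K N (uvec K N lam) k') ∨
    (q N ≠ 0 ∧ (∀ j < N, q j = 0) ∧ w K N N q = q N • B K (In N) (WedgePair.Yset N) ∧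
        ∀ k', 1 ≤ k' → Kr K Finset.univ (w K N N q) k' = frameIdeal K N (Y K N) k') :=
  degenerate_trichotomy K N (by omega) ((rank_hankel1_le_one_iff_Kr_w_one_ne_bot K hk hkN q).mp h)

/-- **A CLASS WHOSE DEGREE-`k` KERNEL IS AT MOST ONE `C(N,k)` SHORT (`C(2N,k) ≤ dim Kr(univ, w_N(q), k) + C(N,k)`, some `1 ≤ k ≤ N − 1`) IS ZERO, PURE OR THE POINT.** -/
theorem degenerate_trichotomy_of_choose_le_finrank_Kr_w_add {k : ℕ} (hk : 1 ≤ k) (hkN : k + 1 ≤ N) {q : ℕ → K}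
    (h : (N + N).choose k ≤ finrank K ↥(Kr K Finset.univ (w K N N q) k) + N.choose k) :
    w K N N q = 0 ∨
    (∃ A lam : K, A ≠ 0 ∧ (∀ j ≤ N, q j = A * lam ^ j) ∧ w K N N q = A • uprod K N lam N ∧
        ∀ k', 1 ≤ k' → Kr K Finset.univ (w K N N q) k' = frameIdeal K N (uvec K N lam) k') ∨
    (q N ≠ 0 ∧ (∀ j < N, q j = 0) ∧ w K N N q = q N • B K (In N) (WedgePair.Yset N) ∧
        ∀ k', 1 ≤ k' → Kr K Finset.univ (w K N N q) k' = frameIdeal K N (Y K N) k') :=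
  degenerate_trichotomy_of_rank_hankel1_le_one K hk hkN ((rank_hankel1_le_one_iff_choose_le_finrank_Kr_w_add K (by omega) q).mpr h)

/-- **NON-DEGENERATE ⇒ `rank H_k(q) ≥ 2` IN EVERY DEGREE `1 ≤ k ≤ N − 1`** (a class killed by no `1`-form). -/
theorem two_le_rank_hankel1_of_Kr_w_one_eq_bot {k : ℕ} (hk : 1 ≤ k) (hkN : k + 1 ≤ N) {q : ℕ → K} (h : Kr K Finset.univ (w K N N q) 1 = ⊥) :
    2 ≤ (hankel1 K N k q).rank := by
  by_contra hlt
  exact (rank_hankel1_le_one_iff_Kr_w_one_ne_bot K hk hkN q).mp (by omega) h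

/-- **NON-DEGENERATE ⇒ `dim Kr(univ, w_N(q), k) + 2·C(N,k) ≤ C(2N,k)` IN EVERY DEGREE `1 ≤ k ≤ N − 1`**: a class killed by no `1`-form is killed by at most `C(2N,k) − 2C(N,k)`
independent `k`-forms. -/
theorem finrank_Kr_w_add_two_mul_choose_le_of_Kr_w_one_eq_bot {k : ℕ} (hk : 1 ≤ k) (hkN : k + 1 ≤ N) {q : ℕ → K} (h : Kr K Finset.univ (w K N N q) 1 = ⊥) :
    finrank K ↥(Kr K Finset.univ (w K N N q) k) + 2 * N.choose k ≤ (N + N).choose k := by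
  have h1 := finrank_Kr_w_add K N k q
  have h2 : N.choose k * 2 ≤ N.choose k * (hankel1 K N k q).rank := Nat.mul_le_mul_left _ (two_le_rank_hankel1_of_Kr_w_one_eq_bot K hk hkN h)
  have h3 : N.choose k * 2 = 2 * N.choose k := Nat.mul_comm _ _
  omega

end Summit.Ventures.HSemireg.Wedge.HankelOuter
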